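import Literature.AlgebraicGeometry.ShimuraVarieties.UnitaryBallQuotientDatum

/-!
# Only finitely many elements of `Γ` have bounded conjugate entries (crux
# `EndoscopicMiddleDegree.OrthogonalEnveloped`, stmt-HodgeConjecture-14300; `--supports`; seat c2, 2026-08-16)

The discreteness brick (i) of the registered residual stub `stub_properlyDiscontinuous` ("`Γ` acts
properly discontinuously on the ball"), consumed by the assembly `stub_properlyDiscontinuousOfBricks`:
for a ball-quotient datum `D` and a real constant `C`, only FINITELY many `γ ∈ Γ = D.Γ ≤ GL_{p+1}(E)` have
`|τ(γ i j)| ≤ C` for every complex embedding `τ : E → ℂ` and all `i, j`.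

Proof. `Γ` is a congruence subgroup (`D.isCongruenceSubgroup`): it contains a principal congruence
subgroup `Γ(n)` with finite index, so `Γ` is the union of finitely many cosets `r Γ(n)`. If `γ = r δ` is
`C`-bounded then `δ = r⁻¹ γ` is `C'`-bounded, `C' = Σ_k M C` with `M ≥ 0` a bound for the conjugates of
the entries of `r⁻¹` (finitely many embeddings, finitely many entries); and the entries of `δ ∈ Γ(n)` are
algebraic integers (`δ = 1 + n A`, `A` with entries in `𝓞_E`). The algebraic integers of `E` all of whose
conjugates are bounded by `C'` form a finite set (Mathlib `NumberField.Embeddings.finite_of_norm_le`), so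
`δ`, hence `γ`, ranges over a finite set.

* `exists_forall_norm_embedding_apply_le` — a uniform bound for the conjugates of the entries of ONE
  matrix over a number field;
* `isIntegral_apply_of_isCongruentOneMod` — entries of `g ≡ 1 (mod n)` (integrally) are integral;
* `finite_setOf_isCongruentOneMod_norm_le` — finitely many `g ∈ GL_m(E)`, `g ≡ 1 (mod n)` integrally,
  with `C`-bounded conjugate entries;
* `stub_congruenceBoundedFinite` (REGISTERED stub of the crux).

References: BMM, N. Bergeron, J. Millson, C. Moeglin, arXiv:1306.1515 = Acta Math. 216 (2016), Part 2
§1.4 (the congruence subgroup `Γ`); A. Borel, *Introduction aux groupes arithmétiques*, Hermann (1969),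
§§7–8 (arithmetic subgroups are discrete); the finiteness of algebraic integers of bounded house is
Mathlib's `NumberField.Embeddings.finite_of_norm_le`.
-/

noncomputable section

-- The crux-workfile namespace `Summit.<P>.<Sub>.Cruxes.…` repeats `HodgeConjecture` (single-conjunct summit).
set_option linter.dupNamespace false

namespace Summit.HodgeConjecture.HodgeConjecture.Cruxes.OrthogonalEnveloped.HeckeGraphChow

open scoped BigOperators
open NumberField
open Literature.AlgebraicGeometry.Motives (SchemeOver)
open Literature.AlgebraicGeometry.ShimuraVarieties

section General

variable {K : Type*} [Field K] [NumberField K] {m : Type*} [Fintype m] [DecidableEq m]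

omit [DecidableEq m] in
/-- The conjugates of the entries of a single matrix over a number field are uniformly bounded, by a
non-negative constant (finitely many embeddings, finitely many entries). [folklore] -/
theorem exists_forall_norm_embedding_apply_le (R : Matrix m m K) :
    ∃ M : ℝ, 0 ≤ M ∧ ∀ (τ : K →+* ℂ) (i j : m), ‖τ (R i j)‖ ≤ M := by
  obtain ⟨M, hM⟩ :=
    Finite.exists_le fun t : (K →+* ℂ) × m × m ↦ ‖t.1 (R t.2.1 t.2.2)‖
  exact ⟨max M 0, le_max_right _ _, fun τ i j ↦ (hM (τ, i, j)).trans (le_max_left _ _)⟩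

omit [NumberField K] [Fintype m] in
/-- The entries of a matrix `g ≡ 1 (mod n)` integrally (`g = 1 + n A`, `A` with entries in `𝓞 K`) are
algebraic integers. [folklore] -/
theorem isIntegral_apply_of_isCongruentOneMod {n : ℕ} {g : Matrix m m K}
    (hg : IsCongruentOneMod n g) (i j : m) : IsIntegral ℤ (g i j) := by
  obtain ⟨A, rfl⟩ := hg
  rw [Matrix.add_apply, Matrix.smul_apply, Matrix.map_apply, Matrix.one_apply]
  refine IsIntegral.add ?_ ((RingOfIntegers.isIntegral_coe (A i j)).nsmul n)
  split_ifs
  exacts [isIntegral_one, isIntegral_zero]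

/-- Finitely many `g ∈ GL_m(K)` with `g ≡ 1 (mod n)` integrally have all conjugates of all entries
bounded by `C`: their entries are algebraic integers all of whose conjugates are bounded by `C`, a finite
set (`NumberField.Embeddings.finite_of_norm_le`), and a matrix is determined by its entries.
[cite: BergeronMillsonMoeglin2016Balls, Part 2 §1.4] -/
theorem finite_setOf_isCongruentOneMod_norm_le (n : ℕ) (C : ℝ) :
    Set.Finite {g : GL m K | IsCongruentOneMod n (g : Matrix m m K) ∧
      ∀ (τ : K →+* ℂ) (i j : m), ‖τ (g i j)‖ ≤ C} := by
  have hT : Set.Finite {f : m → m → K | ∀ i, f i ∈ {v : m → K | ∀ j, v j ∈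
      {x : K | IsIntegral ℤ x ∧ ∀ φ : K →+* ℂ, ‖φ x‖ ≤ C}}} :=
    Set.Finite.pi' fun _ ↦ Set.Finite.pi' fun _ ↦ Embeddings.finite_of_norm_le K ℂ C
  have hinj : Function.Injective fun (g : GL m K) (i j : m) ↦ (g : Matrix m m K) i j :=
    fun a b h ↦ Units.ext (Matrix.ext fun i j ↦ congr_fun (congr_fun h i) j)
  refine (hT.preimage hinj.injOn).subset ?_
  rintro g ⟨hg, hC⟩
  simp only [Set.mem_preimage, Set.mem_setOf_eq]
  exact fun i j ↦ ⟨isIntegral_apply_of_isCongruentOneMod hg i j, fun φ ↦ hC φ i j⟩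

end General

/-- **REGISTERED STUB `stub_congruenceBoundedFinite` (seat c2): only finitely many `γ ∈ Γ` have all
conjugates of all entries bounded by a constant.** `Γ ⊇ Γ(n)` with finite index
(`D.isCongruenceSubgroup`); on the coset of `r`, `γ ↦ r⁻¹ γ` is injective with values in `Γ(n)`, and
`|τ((r⁻¹ γ) i j)| ≤ Σ_k |τ(r⁻¹ i k)| |τ(γ k j)| ≤ Σ_k M C` for `C`-bounded `γ`; conclude by
`finite_setOf_isCongruentOneMod_norm_le` on each of the finitely many cosets.
[cite: BergeronMillsonMoeglin2016Balls, Part 2 §1.4] -/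
theorem stub_congruenceBoundedFinite :
    ∀ {p : ℕ} {X : SchemeOver ℂ} (D : UnitaryBallQuotientDatum p X) (C : ℝ),
      Set.Finite {γ : ↥D.Γ | ∀ (τ : D.E →+* ℂ) (i j : Fin (p + 1)),
        ‖τ ((γ : GL (Fin (p + 1)) D.E) i j)‖ ≤ C} := by
  intro p X D C
  obtain ⟨n, -, -, hfi⟩ := D.isCongruenceSubgroup.2
  set P : Subgroup ↥D.Γ := (principalCongruenceSubgroup (conjRingHom D.E) D.H n).subgroupOf D.Γ
  haveI : P.FiniteIndex := hfi
  -- each of the finitely many cosets of `Γ(n)` in `Γ` contains finitely many `C`-bounded elements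
  have key : ∀ q : ↥D.Γ ⧸ P, Set.Finite {γ : ↥D.Γ | (γ : ↥D.Γ ⧸ P) = q ∧
      ∀ (τ : D.E →+* ℂ) (i j : Fin (p + 1)), ‖τ ((γ : GL (Fin (p + 1)) D.E) i j)‖ ≤ C} := by
    intro q
    obtain ⟨r, rfl⟩ := QuotientGroup.mk_surjective q
    -- a bound `M ≥ 0` for the conjugates of the entries of `r⁻¹`
    obtain ⟨M, hM0, hM⟩ := exists_forall_norm_embedding_apply_le
      (((r : GL (Fin (p + 1)) D.E)⁻¹ : GL (Fin (p + 1)) D.E) : Matrix (Fin (p + 1)) (Fin (p + 1)) D.E)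
    -- `γ ↦ r⁻¹ γ` is injective, with `(Σ_k M C)`-bounded values in `Γ(n)` on the `C`-bounded part of `r Γ(n)`
    have hinj : Function.Injective fun γ : ↥D.Γ ↦
        ((r : GL (Fin (p + 1)) D.E)⁻¹ * (γ : GL (Fin (p + 1)) D.E) : GL (Fin (p + 1)) D.E) :=
      fun a b h ↦ Subtype.ext (mul_left_cancel h)
    refine ((finite_setOf_isCongruentOneMod_norm_le (K := D.E) (m := Fin (p + 1)) n
      (∑ _k : Fin (p + 1), M * C)).preimage hinj.injOn).subset ?_
    rintro γ ⟨hq, hC⟩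
    refine ⟨?_, fun τ i j ↦ ?_⟩
    · -- `r⁻¹ γ ∈ Γ(n)`
      have hmem : r⁻¹ * γ ∈ P := QuotientGroup.eq.mp hq.symm
      exact (Subgroup.mem_subgroupOf.mp hmem).2.1
    · -- `|τ((r⁻¹ γ) i j)| ≤ Σ_k |τ(r⁻¹ i k)| |τ(γ k j)| ≤ Σ_k M C`
      change ‖τ (((((r : GL (Fin (p + 1)) D.E)⁻¹ : GL (Fin (p + 1)) D.E) :
          Matrix (Fin (p + 1)) (Fin (p + 1)) D.E) *
        ((γ : GL (Fin (p + 1)) D.E) : Matrix (Fin (p + 1)) (Fin (p + 1)) D.E)) i j)‖ ≤ _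
      rw [Matrix.mul_apply, map_sum]
      refine (norm_sum_le _ _).trans (Finset.sum_le_sum fun k _ ↦ ?_)
      rw [map_mul, norm_mul]
      exact mul_le_mul (hM τ i k) (hC τ k j) (norm_nonneg _) hM0
  refine (Set.finite_iUnion key).subset fun γ hγ ↦ ?_
  exact Set.mem_iUnion.2 ⟨(γ : ↥D.Γ ⧸ P), rfl, hγ⟩

end Summit.HodgeConjecture.HodgeConjecture.Cruxes.OrthogonalEnveloped.HeckeGraphChow

end
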